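import Literature.MathematicalPhysics.QuantumFieldTheory.Balaban1983to89.BlockAveragingSectionQsstar
import Literature.MathematicalPhysics.QuantumFieldTheory.Balaban1983to89.BlockAveragingSectionPlaq
import Literature.MathematicalPhysics.QuantumFieldTheory.Balaban1983to89.BlockAveragingExpMeanLogContinuous
import Literature.MathematicalPhysics.QuantumFieldTheory.Balaban1983to89.B12ContinuousTransportInvarianceOn
import Literature.MathematicalPhysics.QuantumFieldTheory.Balaban1983to89.Node00.DatumAvLayer
import Literature.MathematicalPhysics.QuantumFieldTheory.Balaban1983to89.Node00.SmallFieldChiOfRecord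
import Literature.MathematicalPhysics.QuantumFieldTheory.Balaban1983to89.B15Claim189CubePin

/-!
# The averaging of record near the face section: the HALF-GUARD of the small-loop average (where the measurable and the continuous
# extensions of print's exp[mean log] agree — an OPEN set containing every `Q^{s*}V`), and the ALTERNATING coarse field whose every
# (0,1)-plaquette, and whose face section's every block-corner (0,1)-plaquette, has plaquette size `dist1 g`

Cell `pub-ymgap`, YM-PLAN Track A (HUMAN RULING D-0062), seat `pub-ymgap-dag-n11-d` (g5; R134 fan-out seat N11 [B14], strategy s2), lane K1⁗
`StabilityBAtRecordR13Sep` = stmt-QuantumFields-20290.  [I] = [Balaban1987RG1] (CMP **109** (1987), (0.3)–(0.4) pp. 252–253), [B7] = [Balaban1985Averaging].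
Bookkeeping over the tree's `BlockAveraging` (the total (0.4) averaging `avgFun ℰ`, its loop variables `loopHol`, guard `Small`), `BlockAveragingExpMeanLog`
(`expMeanLogSU`: print's exp[mean log] on the guard, `1` off it — the averaging OF RECORD `Node00.avOfRecord`) and `BlockAveragingExpMeanLogContinuous`
(`expMeanLogSUc`: a CONTINUOUS extension agreeing with print on the half-guard), `BlockAveragingSection(Plaq∕Qsstar)` (the face section `faceSec V = Q^{s*}V`: loop
variables `1`, plaquette variables `V(∂P)` at block corners and `1` elsewhere).

WHY THIS FILE (the positivity input of this seat's N11 chain `…NoExpansionUnitBranch`, pub-ymgap INBOX DAGN11D-G5-FILED-3): that chain reduced the first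
instance of K1⁗'s N11 conjunct at every small-`εreg` witness to «the event {U cube-rough ∧ Ū cube-rough} is `dU`-null».  To show the event has POSITIVE
Haar measure one exhibits an open set inside it: the averaging of record `blockAvg expMeanLogSU` is NOT continuous (p. 253's logarithm is cut off), but
(§1) on the open HALF-GUARD `{U | ∀ c i, dist1 (loopHol U c i) < δ_N∕2}` it coincides with the continuous `avgFun expMeanLogSUc`, and every face section
lies there (its loop variables are `1`); (§2) for any group element `g` the ALTERNATING coarse field `V_g` (`g` on the direction-0 bonds with odd second label,
`1` elsewhere; the site count `2L^{m+K−j}` is even) has `dist1 (V_g(∂P)) = dist1 g` at EVERY (0,1)-plaquette `P`, and (§3) its face section has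
`dist1 = dist1 g` at the (0,1)-plaquette of every block corner; (§4) CUBE GEOMETRY for an `L`-divisible cube side `S ≥ L` (`1 ≤ m + K`): the covered point
`π(S·a + (L−1)·𝟙)` is at the last position of its block in every direction (`offset_cover_corner`), its `(μ,ν)`-plaquette lies inside `□^∼ = cubeEnl P S a 1`
(`cornerPlaq_mem_plaqInside`), and the centres of the blocks of it and of its unit translates lie in `cubeEnl P S a 3` (`emb_blockOf_corner_mem`; the deck
translation lemma `mem_cubeEnl_of_val_near_cover`).  The measure statement (positivity of {U cube-rough ∧ Ū cube-rough}) is this seat's Theorems-side sequel.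

HONEST SCOPE.  Lattice bookkeeping and one `if`; nothing of Bałaban's estimates; count-neutral; one finite torus — NOT ℝ⁴ ∕ OS ∕ mass gap ∕ Clay.
No `sorry`, no `axiom`, no `def`, no `instance`, no `notation`.
-/

noncomputable section

open scoped Matrix.Norms.L2Operator

namespace Literature.MathematicalPhysics.QuantumFieldTheory.Balaban1983to89.Node00

open T4Continuum AveragingRT BlockAveraging BlockAveragingSection BlockAveragingSectionPlaq BlockAveragingSectionQsstar ExpMeanLog
open B12ContinuousTransportInvarianceOn (continuous_dist1_SU)
open GaugeField (plaqHol)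

variable {N : ℕ} [NeZero N]

/-! ## §1  The half-guard: the averaging of record agrees with the continuous averaging on an open set containing every face section -/

section HalfGuard

variable {P : Params} {j : ℕ}

/-- `Fin N` is nonempty for `N ≠ 0`. [folklore] -/
private theorem nonempty_finN : Nonempty (Fin N) := ⟨⟨0, Nat.pos_of_ne_zero (NeZero.ne N)⟩⟩

/-- On a family within `δ_N∕2` of the identity, the measurable (`expMeanLogSU`) and the continuous (`expMeanLogSUc`) extensions of print's exp[mean log]
have the same average. [cite: Balaban1987RG1, (0.4) p.253] -/
theorem avg_expMeanLogSU_eq_SUc_of_lt_half {ι : Type*} [Fintype ι] [Nonempty ι] (W : ι → SU N)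
    (h : ∀ i, dist1 (W i) < (expMeanLogSU (n := Fin N)).δ / 2) :
    (expMeanLogSU (n := Fin N)).avg W = (expMeanLogSUc (n := Fin N)).avg W := by
  haveI : Nonempty (Fin N) := nonempty_finN
  unfold LoopAverage.avg
  show ESU (W ∘ (LoopAverage.enum ι).symm) = ESUc (W ∘ (LoopAverage.enum ι).symm)
  symm
  refine ESUc_eq_ESU_of_small fun i => ?_
  have hi := h ((LoopAverage.enum ι).symm i)
  exact (le_of_lt hi : _)

/-- **ON THE HALF-GUARD THE AVERAGING OF RECORD IS THE CONTINUOUS AVERAGING**: if every loop variable (0.4) of `U` is within `δ_N∕2` of the identity, then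
`avgFun expMeanLogSU U = avgFun expMeanLogSUc U`. [cite: Balaban1987RG1, (0.4) p.253] -/
theorem avgFun_expMeanLogSU_eq_SUc_of_halfSmall (U : GaugeField P j (SU N))
    (h : ∀ (c : PBond P (j + 1)) (i : Idx P), dist1 (loopHol U c i) < (expMeanLogSU (n := Fin N)).δ / 2) :
    avgFun (expMeanLogSU (n := Fin N)) U = avgFun (expMeanLogSUc (n := Fin N)) U := by
  funext c
  have hsmall : Small (expMeanLogSU (n := Fin N)) U c := fun i =>
    (h c i).trans (by linarith [(expMeanLogSU (n := Fin N)).δ_pos])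
  have hsmall' : Small (expMeanLogSUc (n := Fin N)) U c := fun i => by
    rw [expMeanLogSUc_δ]; exact hsmall i
  unfold avgFun corr
  rw [if_pos hsmall, if_pos hsmall', avg_expMeanLogSU_eq_SUc_of_lt_half _ (h c)]

variable (F : T4Family) in
/-- … so the averaging OF RECORD (`Node00.avOfRecord = blockAvg expMeanLogSU`) is the continuous averaging on the half-guard.
[cite: Balaban1987RG1, (0.4) p.253] -/
theorem avOfRecord_avg_eq_SUc_of_halfSmall (K k : ℕ) (U : GaugeField (F.P K) k (SU N))
    (h : ∀ (c : PBond (F.P K) (k + 1)) (i : Idx (F.P K)), dist1 (loopHol U c i) < (expMeanLogSU (n := Fin N)).δ / 2) :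
    (avOfRecord F N K k).avg U = avgFun (expMeanLogSUc (n := Fin N)) U := by
  rw [avOfRecord_apply, blockAvg_avg]
  exact avgFun_expMeanLogSU_eq_SUc_of_halfSmall U h

/-- **THE HALF-GUARD IS OPEN** (finitely many strict inequalities of continuous loop variables). [cite: Balaban1987RG1, (0.4) p.253 (bookkeeping)] -/
theorem isOpen_halfSmall :
    IsOpen {U : GaugeField P j (SU N) | ∀ (c : PBond P (j + 1)) (i : Idx P), dist1 (loopHol U c i) < (expMeanLogSU (n := Fin N)).δ / 2} := by
  haveI : Nonempty (Fin N) := nonempty_finN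
  have h : {U : GaugeField P j (SU N) | ∀ (c : PBond P (j + 1)) (i : Idx P), dist1 (loopHol U c i) < (expMeanLogSU (n := Fin N)).δ / 2} =
      ⋂ c : PBond P (j + 1), ⋂ i : Idx P, {U | dist1 (loopHol U c i) < (expMeanLogSU (n := Fin N)).δ / 2} := by
    ext U; simp only [Set.mem_setOf_eq, Set.mem_iInter]
  rw [h]
  refine isOpen_iInter_of_finite fun c => isOpen_iInter_of_finite fun i => ?_
  exact isOpen_lt (continuous_dist1_SU.comp ((continuous_apply i).comp (continuous_loopHol c))) continuous_const

/-- **EVERY FACE SECTION LIES IN THE HALF-GUARD**: the loop variables of `faceSec V` are all `1` (standing range `j + 1 ≤ m + K`).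
[cite: Balaban1987RG1, (0.4) p.253] -/
theorem halfSmall_faceSec (hj : j + 1 ≤ P.m + P.K) (V : GaugeField P (j + 1) (SU N)) :
    ∀ (c : PBond P (j + 1)) (i : Idx P), dist1 (loopHol (faceSec V) c i) < (expMeanLogSU (n := Fin N)).δ / 2 := fun c i => by
  rw [loopHol_faceSec hj V c i, GaugeGroup.dist1_one]
  exact half_pos (expMeanLogSU (n := Fin N)).δ_pos

/-- The continuous averaging of a face section returns the coarse field (`E_c(1,…,1) = 1`). [cite: Balaban1987RG1, (0.4)–(0.5) p.253] -/
theorem avgFun_expMeanLogSUc_faceSec (hj : j + 1 ≤ P.m + P.K) (V : GaugeField P (j + 1) (SU N)) :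
    avgFun (expMeanLogSUc (n := Fin N)) (faceSec V) = V := by
  haveI : Nonempty (Fin N) := nonempty_finN
  refine avgFun_faceSec hj _ (fun m => ?_) V
  show ESUc (fun _ : Fin (m + 1) => (1 : SU N)) = 1
  have h : ∀ i : Fin (m + 1), ‖(((fun _ => (1 : SU N)) i : SU N) : Matrix (Fin N) (Fin N) ℂ) - 1‖ ≤ deltaSU (Fin N) / 2 := fun i => by
    simp only [OneMemClass.coe_one, sub_self, norm_zero]
    exact (half_pos deltaSU_pos).le
  apply Subtype.ext
  rw [coe_ESUc_of_small h, eml_eq_exp]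
  simp

end HalfGuard

/-! ## §2  The alternating coarse field: every (0,1)-plaquette has size `dist1 g` -/

section Alternating

variable {P : Params} {j : ℕ}

/-- The label of `y + e_μ` in direction `μ` has the opposite parity (the site count `2L^{m+K−j}` is even). [folklore] -/
private theorem odd_val_shift_self_iff (y : Site P j) (μ : Fin P.d) : Odd ((y.shift μ) μ).val ↔ ¬ Odd (y μ).val := by
  rw [val_shift_self]
  have hn : P.sitesPerDir j = 2 * P.L ^ (P.m + P.K - j) := rfl
  have hlt : (y μ).val < P.sitesPerDir j := ZMod.val_lt _
  by_cases h : (y μ).val + 1 < P.sitesPerDir j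
  · rw [Nat.mod_eq_of_lt h, Nat.odd_add_one]
  · have heq : (y μ).val + 1 = P.sitesPerDir j := by omega
    rw [heq, Nat.mod_self]
    have hodd : Odd (y μ).val := ⟨P.L ^ (P.m + P.K - j) - 1, by omega⟩
    simp [hodd]

/-- **THE ALTERNATING COARSE FIELD**: for every `g`, there is a configuration (on `T^{(j)}`, `d ≥ 2`) all of whose (0,1)-plaquette variables have size
`dist1 g` — put `g` on the direction-0 bonds whose base point has odd label in direction 1, `1` elsewhere: each (0,1)-plaquette reads `g·1·1⁻¹·1⁻¹` or
`1·1·g⁻¹·1⁻¹`. [cite: Balaban1985Averaging, (9) p.19 (bookkeeping)] -/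
theorem exists_field_plaq01_dist1_eq {G : Type*} [GaugeGroup G] (hd : 2 ≤ P.d) (g : G) :
    ∃ V : GaugeField P j G, ∀ (y : Site P j) (h01 : (⟨0, by omega⟩ : Fin P.d) < ⟨1, by omega⟩),
      dist1 (plaqHol V ⟨y, ⟨0, by omega⟩, ⟨1, by omega⟩, h01⟩) = dist1 g := by
  classical
  set μ0 : Fin P.d := ⟨0, by omega⟩ with hμ0
  set μ1 : Fin P.d := ⟨1, by omega⟩ with hμ1
  have hne : μ1 ≠ μ0 := by simp [hμ0, hμ1]
  set V : GaugeField P j G := fun b => if b.dir = μ0 then (if Odd (b.src μ1).val then g else 1) else 1 with hV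
  refine ⟨V, fun y h01 => ?_⟩
  have hflip : Odd ((y.shift μ1) μ1).val ↔ ¬ Odd (y μ1).val := odd_val_shift_self_iff y μ1
  have e1 : V ⟨y, μ0⟩ = if Odd (y μ1).val then g else 1 := by rw [hV]; exact if_pos rfl
  have e2 : V ⟨y.shift μ0, μ1⟩ = 1 := by rw [hV]; exact if_neg hne
  have e3 : V ⟨y.shift μ1, μ0⟩ = if Odd ((y.shift μ1) μ1).val then g else 1 := by rw [hV]; exact if_pos rfl
  have e4 : V ⟨y, μ1⟩ = 1 := by rw [hV]; exact if_neg hne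
  unfold GaugeField.plaqHol
  rw [e1, e2, e3, e4, mul_one, inv_one, mul_one]
  by_cases hy : Odd (y μ1).val
  · have h3 : ¬ Odd ((y.shift μ1) μ1).val := fun h => (hflip.1 h) hy
    rw [if_pos hy, if_neg h3, inv_one, mul_one]
  · have h3 : Odd ((y.shift μ1) μ1).val := hflip.2 hy
    rw [if_neg hy, if_pos h3, one_mul, GaugeGroup.dist1_inv]

end Alternating

/-! ## §3  The face section of a coarse field: block-corner (0,1)-plaquettes carry the coarse plaquette variables -/

section Corner

variable {P : Params} {j : ℕ} {G : Type*} [GaugeGroup G]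

/-- At a fine site at the LAST position of its block in directions `μ < ν`, the `(μ,ν)`-plaquette variable of the face section is the coarse plaquette
variable at the block: `(faceSec V)(∂⟨x, μ, ν⟩) = V(∂⟨blockOf x, μ, ν⟩)`. [cite: Balaban1985Averaging, (9) p.19; Balaban1987RG1, (0.3)–(0.4) pp.252–253] -/
theorem plaqHol_faceSec_of_offsets (hj : j + 1 ≤ P.m + P.K) (V : GaugeField P (j + 1) G) (p : Plaq P j)
    (hμ : offset p.src p.μ = P.L - 1) (hν : offset p.src p.ν = P.L - 1) :
    plaqHol (faceSec V) p = plaqHol V ⟨blockOf p.src, p.μ, p.ν, p.hμν⟩ := by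
  rw [plaqHol_faceSec hj V p, if_pos ⟨hμ, hν⟩]

/-- Hence, for the alternating field of §2 read one level up: at every fine site `x` at the last position of its block in directions 0 and 1, the face section
has a (0,1)-plaquette of size `dist1 g`. [cite: Balaban1985Averaging, (9) p.19 (bookkeeping)] -/
theorem exists_coarse_faceSec_corner_dist1_eq (hd : 2 ≤ P.d) (hj : j + 1 ≤ P.m + P.K) (g : G) :
    ∃ V : GaugeField P (j + 1) G,
      (∀ (y : Site P (j + 1)) (h01 : (⟨0, by omega⟩ : Fin P.d) < ⟨1, by omega⟩),
        dist1 (plaqHol V ⟨y, ⟨0, by omega⟩, ⟨1, by omega⟩, h01⟩) = dist1 g) ∧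
      ∀ (x : Site P j) (h01 : (⟨0, by omega⟩ : Fin P.d) < ⟨1, by omega⟩),
        offset x ⟨0, by omega⟩ = P.L - 1 → offset x ⟨1, by omega⟩ = P.L - 1 →
          dist1 (plaqHol (faceSec V) ⟨x, ⟨0, by omega⟩, ⟨1, by omega⟩, h01⟩) = dist1 g := by
  obtain ⟨V, hV⟩ := exists_field_plaq01_dist1_eq (P := P) (j := j + 1) hd g
  refine ⟨V, hV, fun x h01 h0 h1 => ?_⟩
  rw [plaqHol_faceSec_of_offsets hj V ⟨x, _, _, h01⟩ h0 h1]
  exact hV (blockOf x) h01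

end Corner

/-! ## §4  Cube geometry: every cube of an `L`-divisible partition contains a block-corner (0,1)-plaquette and, three collars out, a cornered coarse plaquette -/

section CubeGeometry

open B14DomainGeom B14.Eq213MaximalDomains B15Eq112TorusCover B15LatticeCubeTorus B15DeterminingSets
open B15Claim189CubePin (cover_add_single)

variable {P : Params}

/-- Collars are monotone in the width. [cite: Balaban1988Convergent, (2.16)–(2.17) p.257 (bookkeeping)] -/
private theorem cubeExt_mono_width {S : ℕ} (a : Pt P.d) {w w' : ℤ} (h : w ≤ w') : cubeExt S a w ⊆ cubeExt S a w' := by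
  intro z hz i
  obtain ⟨h1, h2⟩ := hz i
  constructor <;> linarith

/-- A vector within `w` of a point of the `r`-collar lies in the `(r + w)`-collar. [cite: Balaban1988Convergent, (2.16)–(2.17) p.257 (bookkeeping)] -/
private theorem mem_cubeExt_of_near {S : ℕ} {a z z' : Pt P.d} {r w : ℤ} (hz : z ∈ cubeExt S a r) (h : ∀ i, |z' i - z i| ≤ w) :
    z' ∈ cubeExt S a (r + w) := by
  intro i
  obtain ⟨h1, h2⟩ := hz i
  have h3 := abs_le.1 (h i)
  constructor <;> linarith

/-- **TORUS SITES `val`-CLOSE TO A COVERED COLLAR POINT LIE IN A WIDER COLLAR**: if `z ∈ cubeExt S a r` and every residue label of `t` is within `w` of the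
corresponding label of `π z`, then `t ∈ cubeEnl P S a n` whenever `r + w ≤ n·S` (deck translation between `z` and the standard lift of `π z`).
[cite: Balaban1988Convergent, (2.16)–(2.17) p.257 (bookkeeping)] -/
theorem mem_cubeEnl_of_val_near_cover {S : ℕ} {a z : Pt P.d} {r : ℕ} (hz : z ∈ cubeExt S a (r : ℤ)) {t : Site P 0} {w : ℕ}
    (hnear : ∀ i, |((t i).val : ℤ) - (((cover P z) i).val : ℤ)| ≤ w) {n : ℕ} (hn : r + w ≤ n * S) :
    t ∈ cubeEnl P S a n := by
  obtain ⟨v, hv⟩ := (cover_eq_cover_iff z (lift P (cover P z))).1 (cover_lift (cover P z)).symm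
  refine ⟨lift P t - pmul (per P) v, ?_, ?_⟩
  · have hmem : lift P t - pmul (per P) v ∈ cubeExt S a ((r : ℤ) + (w : ℤ)) := by
      refine mem_cubeExt_of_near hz fun i => ?_
      have hvi : lift P (cover P z) i = z i + pmul (per P) v i := by rw [hv]; rfl
      have e : (lift P t - pmul (per P) v) i - z i = ((t i).val : ℤ) - (((cover P z) i).val : ℤ) := by
        simp only [Pi.sub_apply, lift] at hvi ⊢
        linarith
      rw [e]; exact hnear i
    have hle : ((r : ℤ) + (w : ℤ)) ≤ ((n * S : ℕ) : ℤ) := by exact_mod_cast hn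
    exact cubeExt_mono_width a hle hmem
  · have h := cover_add_pmul (lift P t - pmul (per P) v) v
    rw [sub_add_cancel, cover_lift] at h
    exact h.symm

/-- A fine site and the centre of its block have labels within `L` of each other (standing range). [cite: Balaban1987RG1, (0.1)–(0.3) pp.251–252] -/
theorem abs_val_emb_blockOf_sub_le {j : ℕ} (hj : j + 1 ≤ P.m + P.K) (t : Site P j) (μ : Fin P.d) :
    |(((emb (blockOf t)) μ).val : ℤ) - ((t μ).val : ℤ)| ≤ P.L := by
  rw [Site.val_emb hj, Site.val_blockOf hj]
  have h1 : (t μ).val = (t μ).val / P.L * P.L + (t μ).val % P.L := (Nat.div_add_mod' _ _).symm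
  have h2 : (t μ).val % P.L < P.L := Nat.mod_lt _ P.L_pos
  have h3 : (P.L - 1) / 2 < P.L := by have := P.hL.2; omega
  have h1' : ((t μ).val : ℤ) = (((t μ).val / P.L * P.L : ℕ) : ℤ) + (((t μ).val % P.L : ℕ) : ℤ) := by exact_mod_cast h1
  have h2' : (((t μ).val % P.L : ℕ) : ℤ) < (P.L : ℤ) := by exact_mod_cast h2
  have h3' : (((P.L - 1) / 2 : ℕ) : ℤ) < (P.L : ℤ) := by exact_mod_cast h3
  have h4 : (0 : ℤ) ≤ (((t μ).val % P.L : ℕ) : ℤ) := by positivity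
  have h5 : (0 : ℤ) ≤ (((P.L - 1) / 2 : ℕ) : ℤ) := by positivity
  rw [abs_le, Nat.cast_add]
  constructor <;> linarith

variable (P)

/-- The residue label of `π z` is `z mod N₀` (as an integer). [cite: Balaban1987RG1, (0.1) p.251 (bookkeeping)] -/
private theorem val_cover_int (z : Pt P.d) (μ : Fin P.d) : (((cover P z) μ).val : ℤ) = z μ % (P.sitesPerDir 0 : ℕ) := val_cover z μ

/-- **THE BLOCK-CORNER SITE OF A CUBE**: for `L ∣ S`, the covered point `π(S·a + (L−1)·𝟙)` is at the LAST position of its block in every direction.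
[cite: Balaban1987RG1, (0.3) p.252 (bookkeeping)] -/
theorem offset_cover_corner {S : ℕ} (hLS : P.L ∣ S) (hmK : 1 ≤ P.m + P.K) (a : Pt P.d) (ν : Fin P.d) :
    offset (cover P (fun i => (S : ℤ) * a i + ((P.L - 1 : ℕ) : ℤ))) ν = P.L - 1 := by
  have hL := P.L_pos
  have hL1 := P.hL.2
  have hLn : (P.L : ℤ) ∣ ((P.sitesPerDir 0 : ℕ) : ℤ) := by
    have : P.L ∣ P.sitesPerDir 0 := by
      have := P.sitesPerDir_eq_mul_succ (j := 0) (by omega)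
      exact Dvd.intro_left _ this.symm
    exact_mod_cast this
  unfold offset
  have hv : (((cover P (fun i => (S : ℤ) * a i + ((P.L - 1 : ℕ) : ℤ))) ν).val : ℤ) % (P.L : ℤ) = ((P.L - 1 : ℕ) : ℤ) := by
    rw [val_cover_int, Int.emod_emod_of_dvd _ hLn]
    obtain ⟨k, hk⟩ : (P.L : ℤ) ∣ (S : ℤ) * a ν := Dvd.dvd.mul_right (by exact_mod_cast hLS) _
    rw [hk, Int.add_comm, Int.add_mul_emod_self_left]
    have : ((P.L - 1 : ℕ) : ℤ) < (P.L : ℤ) := by exact_mod_cast (by omega : P.L - 1 < P.L)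
    exact Int.emod_eq_of_lt (by positivity) this
  have key : (((((cover P (fun i => (S : ℤ) * a i + ((P.L - 1 : ℕ) : ℤ))) ν).val % P.L : ℕ)) : ℤ) = ((P.L - 1 : ℕ) : ℤ) := by
    push_cast [Int.natCast_mod] at hv ⊢
    exact hv
  exact_mod_cast key

/-- **THE BLOCK-CORNER (0,1)-PLAQUETTE OF EVERY CUBE LIES INSIDE `□^∼`** (`L ≤ S`): all four corners of the plaquette at `π(S·a + (L−1)·𝟙)` in directions
`μ < ν` lie in `cubeEnl P S a 1`. [cite: Balaban1988Convergent, (2.17) p.257 («p ⊂ □^∼»)] -/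
theorem cornerPlaq_mem_plaqInside {S : ℕ} (hS : P.L ≤ S) (a : Pt P.d) {μ ν : Fin P.d} (hμν : μ < ν) :
    (⟨cover P (fun i => (S : ℤ) * a i + ((P.L - 1 : ℕ) : ℤ)), μ, ν, hμν⟩ : Plaq P 0) ∈
      plaqInside (cubeEnl P S a 1) := by
  have hL1 := P.hL.2
  have hz : ∀ ε : Pt P.d, (∀ i, 0 ≤ ε i ∧ ε i ≤ 1) →
      cover P ((fun i => (S : ℤ) * a i + ((P.L - 1 : ℕ) : ℤ)) + ε) ∈ cubeEnl P S a 1 := by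
    intro ε hε
    refine ⟨_, fun i => ?_, rfl⟩
    obtain ⟨h0, h1⟩ := hε i
    have hL' : ((P.L - 1 : ℕ) : ℤ) = (P.L : ℤ) - 1 := by push_cast [Nat.cast_sub (by omega : 1 ≤ P.L)]; ring
    have hS' : (P.L : ℤ) ≤ (S : ℤ) := by exact_mod_cast hS
    simp only [Pi.add_apply, Nat.one_mul]
    constructor <;> nlinarith
  have hs : ∀ (κ i : Fin P.d), (0 : ℤ) ≤ (Pi.single κ (1 : ℤ) : Pt P.d) i ∧ (Pi.single κ (1 : ℤ) : Pt P.d) i ≤ 1 := by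
    intro κ i; by_cases h : i = κ
    · subst h; simp
    · simp [h]
  refine ⟨?_, ?_, ?_, ?_⟩
  · simpa using hz 0 (fun i => by simp)
  · show (cover P _).shift μ ∈ _
    rw [← cover_add_single]; exact hz _ (hs μ)
  · show (cover P _).shift ν ∈ _
    rw [← cover_add_single]; exact hz _ (hs ν)
  · show ((cover P _).shift μ).shift ν ∈ _
    rw [← cover_add_single, ← cover_add_single, add_assoc]
    refine hz _ fun i => ?_
    have hne : μ ≠ ν := ne_of_lt hμν
    by_cases h1 : i = μ
    · subst h1; simp [hne]
    · by_cases h2 : i = ν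
      · subst h2; simp [Ne.symm hne]
      · simp [h1, h2]

/-- **THE COARSE PLAQUETTE OVER THE BLOCK-CORNER SITE IS CORNERED IN `pts 1 (□^{∼3})`** (`L ≤ S`, `1 ≤ m + K`): for `x = π(S·a + (L−1)·𝟙)` and `μ ≠ ν`, the
centres of the blocks of `x`, `x + e_μ`, `x + e_ν` lie in `cubeEnl P S a 3`; by `blockOf_shift` these blocks are `blockOf x`, `blockOf x + e_μ`, `blockOf x + e_ν`.
[cite: Balaban1988Convergent, (2.13) pp.256–257, (2.16) p.257 (bookkeeping)] -/
theorem emb_blockOf_corner_mem {S : ℕ} (hLS : P.L ∣ S) (hS : P.L ≤ S) (hmK : 1 ≤ P.m + P.K) (a : Pt P.d) (μ ν : Fin P.d) :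
    emb (blockOf (cover P (fun i => (S : ℤ) * a i + ((P.L - 1 : ℕ) : ℤ)))) ∈ cubeEnl P S a 3 ∧
    emb ((blockOf (cover P (fun i => (S : ℤ) * a i + ((P.L - 1 : ℕ) : ℤ)))).shift μ) ∈ cubeEnl P S a 3 ∧
    emb ((blockOf (cover P (fun i => (S : ℤ) * a i + ((P.L - 1 : ℕ) : ℤ)))).shift ν) ∈ cubeEnl P S a 3 := by
  have hL1 := P.hL.2
  set z : Pt P.d := fun i => (S : ℤ) * a i + ((P.L - 1 : ℕ) : ℤ) with hz_def
  -- `z` and its unit translates lie in the `S`-collar (indeed in the `L`-collar)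
  have hzε : ∀ ε : Pt P.d, (∀ i, 0 ≤ ε i ∧ ε i ≤ 1) → z + ε ∈ cubeExt S a ((S : ℕ) : ℤ) := by
    intro ε hε i
    obtain ⟨h0, h1⟩ := hε i
    have hL' : ((P.L - 1 : ℕ) : ℤ) = (P.L : ℤ) - 1 := by push_cast [Nat.cast_sub (by omega : 1 ≤ P.L)]; ring
    have hS' : (P.L : ℤ) ≤ (S : ℤ) := by exact_mod_cast hS
    simp only [hz_def, Pi.add_apply]
    constructor <;> nlinarith
  have hs : ∀ (κ i : Fin P.d), (0 : ℤ) ≤ (Pi.single κ (1 : ℤ) : Pt P.d) i ∧ (Pi.single κ (1 : ℤ) : Pt P.d) i ≤ 1 := by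
    intro κ i; by_cases h : i = κ
    · subst h; simp
    · simp [h]
  have h3 : S + P.L ≤ 3 * S := by omega
  -- the block centre of a covered collar point
  have key : ∀ ε : Pt P.d, (∀ i, 0 ≤ ε i ∧ ε i ≤ 1) → emb (blockOf (cover P (z + ε))) ∈ cubeEnl P S a 3 := fun ε hε =>
    mem_cubeEnl_of_val_near_cover (hzε ε hε) (fun i => abs_val_emb_blockOf_sub_le hmK _ i) h3
  have hshift : ∀ κ : Fin P.d, (blockOf (cover P z)).shift κ = blockOf (cover P (z + Pi.single κ 1)) := fun κ => by
    rw [cover_add_single, blockOf_shift hmK, if_pos (offset_cover_corner P hLS hmK a κ)]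
  refine ⟨?_, ?_, ?_⟩
  · simpa using key 0 (fun i => by simp)
  · rw [hshift]; exact key _ (hs μ)
  · rw [hshift]; exact key _ (hs ν)

end CubeGeometry


end Literature.MathematicalPhysics.QuantumFieldTheory.Balaban1983to89.Node00

end
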